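import Mathlib
import HarnessLib
import Summits.QuantumAdvantage.QuantumAdvantage.Theorems.DigitDialD

set_option linter.dupNamespace false
set_option autoImplicit false

/-!
# DigitDial (F) — JUNTA ⊕ SPREAD LINEAR FORMS mod a general `M` lose the odd-prime u-walk game (cell decomp-qadv, lens 4,
# g20 rev 4)

Prop-definition-free tree twin of §8a of the lens-4 g20 node `DigitDial` (supports item 23109's junta ⊕ linear sub-case).
* `jcell`, `jlStrat`, `ringWinU_jlStrat_cell`, `card_jcell_win_le`, `card_win_jlStrat_le` — a strategy reading the junta
  coordinates `J` (`|J| + 4 ≤ n`) through `A` forms `mu` supported on `J` AND `K` linear forms `lam` mod `M` (`3 ∤ M`) through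
  a JOINT table wins on `≤ (3/4 + 3·M^{A+K}·cos(π/3M)^s)·2ⁿ`, where `s` lower-bounds the number of non-zero coefficients of
  every combination `Σ α_a mu_a + Σ γ_j lam_j` with `γ ≠ 0`; the junta cell indicator is kept INSIDE the win indicator
  (`hiddenCoinsFour` with the junta `J`), so the error term does not pay `2^{|J|}` — conditioning-free.
0 sorry; axioms standard; no `instance`, no `notation`, no `native_decide`; no `def … : Prop`.
-/

noncomputable section

namespace Summit.QuantumAdvantage.QuantumAdvantage.Theorems.DigitDial

open Finset Summit.QuantumAdvantage.AdviceFreeQNC0 Literature.Computability.MetaComplexity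
open TwistedTransfer ConstBells

/-! ## §8  JUNTA ⊕ SPREAD FORMS: strategies reading a few coordinates AND spread linear forms mod `M` (rev 4)

`y_g(u) = tab_g(μ(u), λ(u))` with JUNTA forms `μ_a` supported inside a set `J` (`|J| + 4 ≤ n`) and forms `λ_j` spread RELATIVE
to the junta forms (every combination `Σ α_a μ_a + Σ γ_j λ_j` with `γ ≠ 0` has `≥ s` non-zero coefficients).  The `λ`-cells are
expanded in characters as in §7, and inside them the `μ`-cells are expanded AGAIN: the main term (`γ = 0`) re-indexes into the
`J`-JUNTA strategies `z_v(u) = tab(μ(u), v)`, bounded by the tree's `hiddenCoinsFour` WITH the junta `J`; the error terms are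
twisted sums of CONSTANT strategies against `e_M((Σ α_a μ_a + Σ γ_j λ_j)·u)` (§1).  This is the `ℤ/M` form of the tree's R11′
`LinForms.card_win_le` (prime `p`, junta from `exists_regular_span`, dual subgroup `Γ`); with the junta a separate family the
subgroup is a coordinate factor and no duality bookkeeping is needed.  Junta coordinates are junta forms (`μ_i = e_i`), so
JUNTA ⊕ YOUNG-SYMMETRIC strategies (blocks of any sizes: the small ones go into the junta) are covered: `youngJunta_card_win_le`. -/

section JuntaForms

variable {n A K : ℕ} {M : ℕ} [NeZero M]

/-- The junta ⊕ forms strategy `y_g(u) = tab_g(μ(u), λ(u))`. -/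
def jlStrat (mu : Fin A → Fin n → ZMod M) (lam : Fin K → Fin n → ZMod M)
    (tab : Fin (n + 1) → (Fin A → ZMod M) → (Fin K → ZMod M) → Bool) : Fin (n + 1) → (Fin n → Bool) → Bool :=
  fun g u => tab g (linVal mu u) (linVal lam u)

/-- The junta strategy played on the `λ`-cell `v`: `z_v(u) = tab(μ(u), v)`. -/
def jStrat (mu : Fin A → Fin n → ZMod M) (tab : Fin (n + 1) → (Fin A → ZMod M) → (Fin K → ZMod M) → Bool)
    (v : Fin K → ZMod M) : Fin (n + 1) → (Fin n → Bool) → Bool :=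
  fun g u => tab g (linVal mu u) v

/-- The constant strategy played on the cell `(a, v)`. -/
def cellY₂ (tab : Fin (n + 1) → (Fin A → ZMod M) → (Fin K → ZMod M) → Bool) (a : Fin A → ZMod M)
    (v : Fin K → ZMod M) : Finset (Fin (n + 1)) :=
  univ.filter fun g => tab g a v = true

omit [NeZero M] in
/-- On the cell `(a, v)` the strategy is the constant strategy `cellY₂ tab a v`. [bookkeeping] -/
theorem ringWinU_jlStrat_cell (c : ℕ) (mu : Fin A → Fin n → ZMod M) (lam : Fin K → Fin n → ZMod M)
    (tab : Fin (n + 1) → (Fin A → ZMod M) → (Fin K → ZMod M) → Bool) {u : Fin n → Bool} {a : Fin A → ZMod M}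
    {v : Fin K → ZMod M} (ha : linVal mu u = a) (hv : linVal lam u = v) :
    ringWinU c (jlStrat mu lam tab) u = ringWinU c (fun g _ => decide (g ∈ cellY₂ tab a v)) u := by
  refine Summit.QuantumAdvantage.AdviceFreeQNC0.UnreadTwist.ringWinU_congr fun g => ?_
  unfold jlStrat cellY₂
  rw [ha, hv]
  simp

omit [NeZero M] in
/-- On the `μ`-cell `a` the junta strategy `z_v` is the constant strategy `cellY₂ tab a v`. [bookkeeping] -/
theorem ringWinU_jStrat_cell (c : ℕ) (mu : Fin A → Fin n → ZMod M)
    (tab : Fin (n + 1) → (Fin A → ZMod M) → (Fin K → ZMod M) → Bool) (v : Fin K → ZMod M) {u : Fin n → Bool}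
    {a : Fin A → ZMod M} (ha : linVal mu u = a) :
    ringWinU c (jStrat mu tab v) u = ringWinU c (fun g _ => decide (g ∈ cellY₂ tab a v)) u := by
  refine Summit.QuantumAdvantage.AdviceFreeQNC0.UnreadTwist.ringWinU_congr fun g => ?_
  unfold jStrat cellY₂
  rw [ha]
  simp

omit [NeZero M] in
/-- Junta forms supported in `J` see only `u|_J`. [bookkeeping] -/
theorem linVal_eq_of_agree (mu : Fin A → Fin n → ZMod M) {J : Finset (Fin n)} (hmu : ∀ a i, i ∉ J → mu a i = 0)
    {u v : Fin n → Bool} (huv : ∀ i ∈ J, u i = v i) : linVal mu u = linVal mu v := by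
  funext a
  unfold linVal
  refine Finset.sum_congr rfl fun i _ => ?_
  by_cases hi : i ∈ J
  · rw [huv i hi]
  · rw [hmu a i hi]; simp

/-- Product of two linear phases = the phase of the sum form. [bookkeeping] -/
theorem stdAddChar_dot_mul (β β' : Fin n → ZMod M) (u : Fin n → Bool) :
    (ZMod.stdAddChar (∑ i : Fin n, if u i then β i else 0) : ℂ) *
        (ZMod.stdAddChar (∑ i : Fin n, if u i then β' i else 0) : ℂ) =
      (ZMod.stdAddChar (∑ i : Fin n, if u i then (β i + β' i) else 0) : ℂ) := by
  have hsum : (∑ i : Fin n, if u i then β i else 0) + (∑ i : Fin n, if u i then β' i else 0) =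
      ∑ i : Fin n, if u i then (β i + β' i) else 0 := by
    rw [← Finset.sum_add_distrib]
    refine Finset.sum_congr rfl fun i _ => ?_
    split_ifs <;> simp
  rw [← AddChar.map_add_eq_mul, hsum]

/-- **The mixed cell count** (cell `(a, v)` of junta forms `μ` and forms `λ`): for a constant strategy `Y`,
`#{u : μ(u) = a, λ(u) = v, WIN_Y(u)} ≤ #{u : μ(u) = a, WIN_Y(u)}/M^K + 3·cos(π/(3M))^s·2ⁿ`, where `s` bounds from below
the number of non-zero coefficients of every `Σ α_a μ_a + Σ γ_j λ_j` with `γ ≠ 0` (`3 ∤ M`). -/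
theorem card_jcell_win_le (hM3 : M.Coprime 3) (c : ℕ) (Y : Finset (Fin (n + 1)))
    (mu : Fin A → Fin n → ZMod M) (lam : Fin K → Fin n → ZMod M) (a : Fin A → ZMod M) (v : Fin K → ZMod M) {s : ℕ}
    (hdist : ∀ (α : Fin A → ZMod M) (γ : Fin K → ZMod M), γ ≠ 0 →
      s ≤ (univ.filter fun i : Fin n => (∑ a', α a' * mu a' i + ∑ j, γ j * lam j i) ≠ 0).card) :
    ((univ.filter fun u : Fin n → Bool =>
        ringWinU c (fun g _ => decide (g ∈ Y)) u = true ∧ linVal mu u = a ∧ linVal lam u = v).card : ℝ) ≤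
      ((univ.filter fun u : Fin n → Bool =>
        ringWinU c (fun g _ => decide (g ∈ Y)) u = true ∧ linVal mu u = a).card : ℝ) / (M : ℝ) ^ K +
      3 * Real.cos (Real.pi / (3 * M)) ^ s * (2 : ℝ) ^ n := by
  classical
  set ρ := Real.cos (Real.pi / (3 * M)) with hρ
  have hρ0 : 0 ≤ ρ := TwistM.cos_nonneg M
  have hρ1 : ρ ≤ 1 := Real.cos_le_one _
  set W : (Fin n → Bool) → Prop := fun u => ringWinU c (fun g _ => decide (g ∈ Y)) u = true with hW
  set G : (Fin n → Bool) → ℂ := fun u => if W u then (1 : ℂ) else 0 with hG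
  set F : (Fin n → Bool) → ℂ := fun u => if W u ∧ linVal mu u = a then (1 : ℂ) else 0 with hF
  set A₀ : ℝ := ((univ.filter fun u : Fin n → Bool => W u ∧ linVal mu u = a).card : ℝ) with hA₀
  have hMK : ((M : ℂ) ^ K) ≠ 0 := pow_ne_zero _ (by exact_mod_cast NeZero.ne M)
  have hMpos : (0 : ℝ) < M := by exact_mod_cast Nat.pos_of_ne_zero (NeZero.ne M)
  set T : (Fin K → ZMod M) → ℂ := fun γ => ∑ u : Fin n → Bool,
    (ZMod.stdAddChar (∑ i : Fin n, if u i then ∑ j, γ j * lam j i else 0) : ℂ) * F u with hT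
  -- Step 1: the count as a character sum over the `λ`-cells
  have hcount : (((univ.filter fun u : Fin n → Bool => W u ∧ linVal mu u = a ∧ linVal lam u = v).card : ℕ) : ℂ) =
      ((M : ℂ) ^ K)⁻¹ * ∑ γ : Fin K → ZMod M, (ZMod.stdAddChar (-∑ j, γ j * v j) : ℂ) * T γ := by
    rw [Finset.natCast_card_filter]
    have hu : ∀ u : Fin n → Bool, (if W u ∧ linVal mu u = a ∧ linVal lam u = v then (1 : ℂ) else 0) =
        (if (fun j => ∑ i, if u i then lam j i else 0) = v then F u else 0) := by
      intro u
      show (if W u ∧ linVal mu u = a ∧ linVal lam u = v then (1 : ℂ) else 0) = (if linVal lam u = v then F u else 0)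
      by_cases h1 : W u <;> by_cases h2 : linVal mu u = a <;> by_cases h3 : linVal lam u = v <;> simp [F, h1, h2, h3]
    simp_rw [hu]
    exact TwoModuli.sum_cell_eq_sum_twisted lam v F
  -- Step 2a: `T 0` is the `μ`-cell count
  have hT0 : ‖T 0‖ ≤ A₀ := by
    have h0 : T 0 = (((univ.filter fun u : Fin n → Bool => W u ∧ linVal mu u = a).card : ℕ) : ℂ) := by
      rw [hT, Finset.natCast_card_filter]
      refine Finset.sum_congr rfl fun u _ => ?_
      have : (∑ i : Fin n, if u i then ∑ j : Fin K, (0 : Fin K → ZMod M) j * lam j i else 0) = 0 := by simp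
      rw [this, AddChar.map_zero_eq_one, one_mul]
    rw [h0, Complex.norm_natCast]
  -- Step 2b: `γ ≠ 0`: expand the `μ`-cell in characters too; every term is a constant-strategy twisted sum
  have hcardα : (Finset.univ : Finset (Fin A → ZMod M)).card = M ^ A := by
    rw [Finset.card_univ, Fintype.card_fun, ZMod.card, Fintype.card_fin]
  have hTγ : ∀ γ : Fin K → ZMod M, γ ≠ 0 → ‖T γ‖ ≤ 3 * ρ ^ s * (2 : ℝ) ^ n := by
    intro γ hγ
    set F' : (Fin n → Bool) → ℂ := fun u =>
      (ZMod.stdAddChar (∑ i : Fin n, if u i then ∑ j, γ j * lam j i else 0) : ℂ) * G u with hF'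
    have hTF : T γ = ∑ u : Fin n → Bool, (if (fun a' => ∑ i, if u i then mu a' i else 0) = a then F' u else 0) := by
      rw [hT]
      refine Finset.sum_congr rfl fun u _ => ?_
      show (ZMod.stdAddChar (∑ i : Fin n, if u i then ∑ j, γ j * lam j i else 0) : ℂ) * F u =
        (if linVal mu u = a then F' u else 0)
      by_cases h1 : W u <;> by_cases h2 : linVal mu u = a <;> simp [F, F', G, h1, h2]
    rw [hTF, TwoModuli.sum_cell_eq_sum_twisted mu a F']
    have hinner : ∀ α : Fin A → ZMod M,
        ‖(ZMod.stdAddChar (-∑ a', α a' * a a') : ℂ) * ∑ u : Fin n → Bool,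
          (ZMod.stdAddChar (∑ i : Fin n, if u i then ∑ a', α a' * mu a' i else 0) : ℂ) * F' u‖ ≤
          3 * ρ ^ s * (2 : ℝ) ^ n := by
      intro α
      rw [norm_mul, ZMod.stdAddChar_apply, Circle.norm_coe, one_mul]
      have hcomb : ∀ u : Fin n → Bool,
          (ZMod.stdAddChar (∑ i : Fin n, if u i then ∑ a', α a' * mu a' i else 0) : ℂ) * F' u =
            G u * (ZMod.stdAddChar (∑ i : Fin n, if u i then (∑ a', α a' * mu a' i + ∑ j, γ j * lam j i) else 0) : ℂ) := by
        intro u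
        rw [hF']
        show (ZMod.stdAddChar (∑ i : Fin n, if u i then ∑ a', α a' * mu a' i else 0) : ℂ) *
            ((ZMod.stdAddChar (∑ i : Fin n, if u i then ∑ j, γ j * lam j i else 0) : ℂ) * G u) = _
        rw [← mul_assoc, stdAddChar_dot_mul (fun i => ∑ a', α a' * mu a' i) (fun i => ∑ j, γ j * lam j i) u, mul_comm]
      simp_rw [hcomb]
      refine (TwistM.corr_win_le hρ0 (fun b hb w => TwistM.site_contract hM3 hb w) c Y
        (fun i => ∑ a', α a' * mu a' i + ∑ j, γ j * lam j i)).trans ?_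
      have hpow : ρ ^ (univ.filter fun i : Fin n => (∑ a', α a' * mu a' i + ∑ j, γ j * lam j i) ≠ 0).card ≤ ρ ^ s :=
        pow_le_pow_of_le_one hρ0 hρ1 (hdist α γ hγ)
      have h2 : (0 : ℝ) ≤ (2 : ℝ) ^ n := by positivity
      nlinarith
    have hMA : (0 : ℝ) < (M : ℝ) ^ A := by positivity
    rw [norm_mul, norm_inv, norm_pow, Complex.norm_natCast]
    calc ((M : ℝ) ^ A)⁻¹ * ‖∑ α : Fin A → ZMod M, (ZMod.stdAddChar (-∑ a', α a' * a a') : ℂ) *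
          ∑ u : Fin n → Bool, (ZMod.stdAddChar (∑ i : Fin n, if u i then ∑ a', α a' * mu a' i else 0) : ℂ) * F' u‖
        ≤ ((M : ℝ) ^ A)⁻¹ * ∑ α : Fin A → ZMod M, (3 * ρ ^ s * (2 : ℝ) ^ n) :=
          mul_le_mul_of_nonneg_left ((norm_sum_le _ _).trans (Finset.sum_le_sum fun α _ => hinner α)) (by positivity)
      _ = 3 * ρ ^ s * (2 : ℝ) ^ n := by
          rw [Finset.sum_const, hcardα, nsmul_eq_mul]
          push_cast
          rw [← mul_assoc, inv_mul_cancel₀ (ne_of_gt hMA), one_mul]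
  have hTall : ∀ γ : Fin K → ZMod M, ‖(ZMod.stdAddChar (-∑ j, γ j * v j) : ℂ) * T γ‖ ≤
      (if γ = 0 then A₀ else 0) + 3 * ρ ^ s * (2 : ℝ) ^ n := by
    intro γ
    rw [norm_mul, ZMod.stdAddChar_apply, Circle.norm_coe, one_mul]
    have hρn : 0 ≤ 3 * ρ ^ s * (2 : ℝ) ^ n := by positivity
    by_cases hγ : γ = 0
    · rw [if_pos hγ, hγ]; linarith
    · rw [if_neg hγ]; linarith [hTγ γ hγ]
  -- Step 3: assemble
  have hcardγ : (Finset.univ : Finset (Fin K → ZMod M)).card = M ^ K := by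
    rw [Finset.card_univ, Fintype.card_fun, ZMod.card, Fintype.card_fin]
  have hsum : ‖∑ γ : Fin K → ZMod M, (ZMod.stdAddChar (-∑ j, γ j * v j) : ℂ) * T γ‖ ≤
      A₀ + (M : ℝ) ^ K * (3 * ρ ^ s * (2 : ℝ) ^ n) := by
    refine (norm_sum_le _ _).trans ?_
    refine (Finset.sum_le_sum fun γ _ => hTall γ).trans ?_
    rw [Finset.sum_add_distrib, Finset.sum_ite_eq' univ (0 : Fin K → ZMod M), if_pos (Finset.mem_univ _),
      Finset.sum_const, hcardγ, nsmul_eq_mul]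
    push_cast
    exact le_rfl
  have hreal : (((univ.filter fun u : Fin n → Bool => W u ∧ linVal mu u = a ∧ linVal lam u = v).card : ℕ) : ℝ) =
      ‖(((univ.filter fun u : Fin n → Bool => W u ∧ linVal mu u = a ∧ linVal lam u = v).card : ℕ) : ℂ)‖ := by
    rw [Complex.norm_natCast]
  have hMr : (0 : ℝ) < (M : ℝ) ^ K := by positivity
  have hMne : ((M : ℝ) ^ K) ≠ 0 := ne_of_gt hMr
  rw [hreal, hcount, norm_mul, norm_inv, norm_pow, Complex.norm_natCast]
  calc ((M : ℝ) ^ K)⁻¹ * ‖∑ γ : Fin K → ZMod M, (ZMod.stdAddChar (-∑ j, γ j * v j) : ℂ) * T γ‖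
      ≤ ((M : ℝ) ^ K)⁻¹ * (A₀ + (M : ℝ) ^ K * (3 * ρ ^ s * (2 : ℝ) ^ n)) :=
        mul_le_mul_of_nonneg_left hsum (by positivity)
    _ = A₀ / (M : ℝ) ^ K + 3 * ρ ^ s * (2 : ℝ) ^ n := by
        rw [mul_add, inv_mul_eq_div, ← mul_assoc, inv_mul_cancel₀ hMne, one_mul]

/-- **Junta ⊕ spread forms lose** (general modulus `3 ∤ M`): with junta forms supported in `J`, `|J| + 4 ≤ n`, and forms
spread relative to them (parameter `s`), `#WIN(jlStrat μ λ tab) ≤ (3/4 + 3·M^{A+K}·cos(π/(3M))^s)·2ⁿ`. -/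
theorem card_win_jlStrat_le (hM3 : M.Coprime 3) (c : ℕ) (J : Finset (Fin n)) (hJ : J.card + 4 ≤ n)
    (mu : Fin A → Fin n → ZMod M) (hmu : ∀ a i, i ∉ J → mu a i = 0) (lam : Fin K → Fin n → ZMod M) {s : ℕ}
    (hdist : ∀ (α : Fin A → ZMod M) (γ : Fin K → ZMod M), γ ≠ 0 →
      s ≤ (univ.filter fun i : Fin n => (∑ a', α a' * mu a' i + ∑ j, γ j * lam j i) ≠ 0).card)
    (tab : Fin (n + 1) → (Fin A → ZMod M) → (Fin K → ZMod M) → Bool) :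
    ((univ.filter fun u : Fin n → Bool => ringWinU c (jlStrat mu lam tab) u = true).card : ℝ) ≤
      (3 / 4 + 3 * (M : ℝ) ^ (A + K) * Real.cos (Real.pi / (3 * M)) ^ s) * (2 : ℝ) ^ n := by
  classical
  set ρ := Real.cos (Real.pi / (3 * M)) with hρ
  set E : ℝ := 3 * ρ ^ s * (2 : ℝ) ^ n with hE
  have hMpos : (0 : ℝ) < M := by exact_mod_cast Nat.pos_of_ne_zero (NeZero.ne M)
  -- fibre decomposition over the cells `(v, a)`
  have hsplit := Finset.card_eq_sum_card_fiberwise (f := fun u : Fin n → Bool => (linVal lam u, linVal mu u))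
    (s := univ.filter fun u : Fin n → Bool => ringWinU c (jlStrat mu lam tab) u = true)
    (t := (univ : Finset ((Fin K → ZMod M) × (Fin A → ZMod M)))) (fun _ _ => Finset.mem_univ _)
  have hfib : ∀ (v : Fin K → ZMod M) (a : Fin A → ZMod M),
      ((univ.filter fun u : Fin n → Bool => ringWinU c (jlStrat mu lam tab) u = true).filter
        fun u => (linVal lam u, linVal mu u) = (v, a)) = univ.filter fun u : Fin n → Bool =>
          ringWinU c (fun g _ => decide (g ∈ cellY₂ tab a v)) u = true ∧ linVal mu u = a ∧ linVal lam u = v := by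
    intro v a
    rw [Finset.filter_filter]
    refine Finset.filter_congr fun u _ => ?_
    rw [Prod.mk.injEq]
    constructor
    · rintro ⟨hw, hv, ha⟩; exact ⟨(ringWinU_jlStrat_cell c mu lam tab ha hv) ▸ hw, ha, hv⟩
    · rintro ⟨hw, ha, hv⟩; exact ⟨(ringWinU_jlStrat_cell c mu lam tab ha hv).symm ▸ hw, hv, ha⟩
  -- the main terms of one `λ`-cell re-index into the junta strategy `z_v`
  have hmain : ∀ v : Fin K → ZMod M, (∑ a : Fin A → ZMod M, ((univ.filter fun u : Fin n → Bool =>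
      ringWinU c (fun g _ => decide (g ∈ cellY₂ tab a v)) u = true ∧ linVal mu u = a).card : ℝ)) ≤
        (3 / 4) * (2 : ℝ) ^ n := by
    intro v
    have hz := Finset.card_eq_sum_card_fiberwise (f := linVal mu)
      (s := univ.filter fun u : Fin n → Bool => ringWinU c (jStrat mu tab v) u = true)
      (t := (univ : Finset (Fin A → ZMod M))) (fun _ _ => Finset.mem_univ _)
    have hzfib : ∀ a : Fin A → ZMod M, ((univ.filter fun u : Fin n → Bool => ringWinU c (jStrat mu tab v) u = true).filter
        fun u => linVal mu u = a) = univ.filter fun u : Fin n → Bool =>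
          ringWinU c (fun g _ => decide (g ∈ cellY₂ tab a v)) u = true ∧ linVal mu u = a := by
      intro a
      rw [Finset.filter_filter]
      refine Finset.filter_congr fun u _ => ?_
      constructor
      · rintro ⟨hw, ha⟩; exact ⟨(ringWinU_jStrat_cell c mu tab v ha) ▸ hw, ha⟩
      · rintro ⟨hw, ha⟩; exact ⟨(ringWinU_jStrat_cell c mu tab v ha).symm ▸ hw, ha⟩
    have hJ4 := hiddenCoinsFour n c J hJ (jStrat mu tab v) (fun g u w huw => by
      unfold jStrat; rw [linVal_eq_of_agree mu hmu huw])
    rw [hz] at hJ4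
    push_cast at hJ4
    calc (∑ a : Fin A → ZMod M, ((univ.filter fun u : Fin n → Bool =>
          ringWinU c (fun g _ => decide (g ∈ cellY₂ tab a v)) u = true ∧ linVal mu u = a).card : ℝ))
        = ∑ a : Fin A → ZMod M, ((((univ.filter fun u : Fin n → Bool =>
            ringWinU c (jStrat mu tab v) u = true).filter fun u => linVal mu u = a).card : ℕ) : ℝ) := by
          refine Finset.sum_congr rfl fun a _ => ?_
          rw [hzfib a]
      _ ≤ (3 / 4) * (2 : ℝ) ^ n := hJ4
  have hcardK : (Finset.univ : Finset (Fin K → ZMod M)).card = M ^ K := by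
    rw [Finset.card_univ, Fintype.card_fun, ZMod.card, Fintype.card_fin]
  have hcardA : (Finset.univ : Finset (Fin A → ZMod M)).card = M ^ A := by
    rw [Finset.card_univ, Fintype.card_fun, ZMod.card, Fintype.card_fin]
  have hMK : (M : ℝ) ^ K ≠ 0 := pow_ne_zero _ (ne_of_gt hMpos)
  rw [hsplit]
  push_cast
  rw [Fintype.sum_prod_type]
  calc (∑ v : Fin K → ZMod M, ∑ a : Fin A → ZMod M,
        ((((univ.filter fun u : Fin n → Bool => ringWinU c (jlStrat mu lam tab) u = true).filter
          fun u => (linVal lam u, linVal mu u) = (v, a)).card : ℕ) : ℝ))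
      ≤ ∑ v : Fin K → ZMod M, ((3 / 4) * (2 : ℝ) ^ n / (M : ℝ) ^ K + (M : ℝ) ^ A * E) := by
        refine Finset.sum_le_sum fun v _ => ?_
        calc (∑ a : Fin A → ZMod M, ((((univ.filter fun u : Fin n → Bool =>
              ringWinU c (jlStrat mu lam tab) u = true).filter fun u => (linVal lam u, linVal mu u) = (v, a)).card : ℕ) : ℝ))
            ≤ ∑ a : Fin A → ZMod M, (((univ.filter fun u : Fin n → Bool =>
                ringWinU c (fun g _ => decide (g ∈ cellY₂ tab a v)) u = true ∧ linVal mu u = a).card : ℝ) / (M : ℝ) ^ K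
                + E) := by
              refine Finset.sum_le_sum fun a _ => ?_
              rw [hfib v a]
              exact card_jcell_win_le hM3 c (cellY₂ tab a v) mu lam a v hdist
          _ = (∑ a : Fin A → ZMod M, ((univ.filter fun u : Fin n → Bool =>
                ringWinU c (fun g _ => decide (g ∈ cellY₂ tab a v)) u = true ∧ linVal mu u = a).card : ℝ)) / (M : ℝ) ^ K
                + (M : ℝ) ^ A * E := by
              rw [Finset.sum_add_distrib, Finset.sum_div, Finset.sum_const, hcardA, nsmul_eq_mul]
              push_cast
              ring
          _ ≤ (3 / 4) * (2 : ℝ) ^ n / (M : ℝ) ^ K + (M : ℝ) ^ A * E := by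
              have := div_le_div_of_nonneg_right (hmain v) (le_of_lt (by positivity : (0 : ℝ) < (M : ℝ) ^ K))
              linarith
    _ = (3 / 4 + 3 * (M : ℝ) ^ (A + K) * ρ ^ s) * (2 : ℝ) ^ n := by
        rw [Finset.sum_const, hcardK, nsmul_eq_mul, hE]
        push_cast
        have hc : (M : ℝ) ^ K * ((3 / 4) * (2 : ℝ) ^ n / (M : ℝ) ^ K) = (3 / 4) * (2 : ℝ) ^ n := by
          field_simp
        rw [mul_add, hc, pow_add]
        ring

/-! ### Junta ⊕ Young-symmetric strategies -/

/-- The coordinate forms of the junta `J` (through `J.equivFin`). -/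
def coordForm (M : ℕ) (J : Finset (Fin n)) : Fin J.card → Fin n → ZMod M :=
  fun a i => if i = (J.equivFin.symm a : Fin n) then 1 else 0

omit [NeZero M] in
/-- Coordinate forms are supported in `J`. [bookkeeping] -/
theorem coordForm_support (J : Finset (Fin n)) (a : Fin J.card) (i : Fin n) (hi : i ∉ J) : coordForm M J a i = 0 := by
  unfold coordForm
  rw [if_neg]
  intro h
  exact hi (h ▸ (J.equivFin.symm a).2)

omit [NeZero M] in
/-- A combination `Σ α_a e_a + Σ γ_b 1_{W_b}` equals `γ_b` on a block `W_b` disjoint from `J`. [bookkeeping] -/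
theorem combo_eq_on_block (J : Finset (Fin n)) {B : ℕ} (W : Fin B → Finset (Fin n))
    (hdisj : ∀ b b', b ≠ b' → Disjoint (W b) (W b')) (hWJ : ∀ b, Disjoint (W b) J)
    (α : Fin J.card → ZMod M) (γ : Fin B → ZMod M) {b : Fin B} {i : Fin n} (hi : i ∈ W b) :
    (∑ a, α a * coordForm M J a i + ∑ j, γ j * blockForm M W j i) = γ b := by
  have hiJ : i ∉ J := fun h => Finset.disjoint_left.1 (hWJ b) hi h
  rw [sum_mul_blockForm_of_mem W hdisj γ hi]
  have : (∑ a, α a * coordForm M J a i) = 0 :=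
    Finset.sum_eq_zero fun a _ => by rw [coordForm_support J a i hiJ, mul_zero]
  rw [this, zero_add]

omit [NeZero M] in
/-- Spreadness of the block forms relative to the junta coordinate forms: `≥ min_b |W_b|`. -/
theorem blockForm_dist_junta (J : Finset (Fin n)) {B : ℕ} (W : Fin B → Finset (Fin n))
    (hdisj : ∀ b b', b ≠ b' → Disjoint (W b) (W b')) (hWJ : ∀ b, Disjoint (W b) J)
    {s : ℕ} (hs : ∀ b, s ≤ (W b).card) (α : Fin J.card → ZMod M) (γ : Fin B → ZMod M) (hγ : γ ≠ 0) :
    s ≤ (univ.filter fun i : Fin n => (∑ a, α a * coordForm M J a i + ∑ j, γ j * blockForm M W j i) ≠ 0).card := by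
  obtain ⟨b, hb⟩ : ∃ b, γ b ≠ 0 := by
    by_contra h
    push Not at h
    exact hγ (funext h)
  refine (hs b).trans (Finset.card_le_card fun i hi => ?_)
  rw [Finset.mem_filter, combo_eq_on_block J W hdisj hWJ α γ hi]
  exact ⟨Finset.mem_univ _, hb⟩

end JuntaForms

end Summit.QuantumAdvantage.QuantumAdvantage.Theorems.DigitDial
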